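import Mathlib
import Literature.Analysis.PDE.InverseSquareChannelEstimateCompact
import Literature.Analysis.PDE.InverseSquareWaveExistence
import Literature.Analysis.PDE.Wave1DFarEnergyLimits
import Literature.Analysis.Calculus.EnergyTailCutoff
import Literature.Analysis.Calculus.TwoVariablePartials
import HarnessLib

/-!
# The exact inverse-square exterior channel estimate for finite-energy data (density step)

Analysis/PDE support file (everything proved). Fix `n`, a smooth `ι = 1/x` on `[½,∞)` with smooth
primitive. There is `c = c(n, ι) > 0` such that for all Cauchy data `h ∈ C²`, `g ∈ C¹` with FINITE
energy on `(1,∞)` (`h'², n(n+1)ι²h², g²` integrable) the exact inverse-square wave `φ` with these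
data
(`InverseSquareWaveExistence`) has two channel limits `L± = lim_{t→±∞} ∫_{x>1+|t|} e[φ](t,x) dx`,
and for every `δ > 0` there is an explicit kernel datum `(P, Q)` (Darboux ladders of Taylor
polynomials at `x = 1`) with

  `c ∫_1^X ((h−P)')² + n(n+1)ι²(h−P)² + (g−Q)² ≤ L⁺ + L⁻ + δ`   for every `X ≥ 1`

(`inverseSquare_channel_estimate`). Proof: cut the data off at scale `R` (`EnergyTailCutoff`: far
part of energy `η → 0`), apply the compactly supported statement
(`InverseSquareChannelEstimateCompact`) to the cut-off data, and compare the two waves through the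
energy of their difference (`Wave1DFarEnergyLimits`: `E[φ_R] ≤ 2E[φ] + 2η`, data splitting
`E[d − κ] ≤ 2E[d_R − κ] + 2η`). This is the 1D form of the exterior energy estimate for radial waves
in odd dimension outside a ball modulo its kernel (Kenig–Lawrie–Liu–Schlag 2015, Thm. 5), the
`V₀`-half of the far-side estimate of `FixedModeChannels` (route PhotonSphereChannels,
stmt-FinalStateConjecture-10048).
-/

noncomputable section

namespace Literature.Analysis.PDE

open Set Filter Topology MeasureTheory Finset Literature.Analysis.ODE Literature.Analysis.Calculus

variable {ι : ℝ → ℝ}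

/-- The residual of a `C²` function is continuous, and a function solving the equation on
`{x > ½}` has residual vanishing on `{x ≥ 1}`. [folklore] -/
theorem inverseSquare_residual {W : ℝ → ℝ} (hW : Continuous W) {φ : ℝ → ℝ → ℝ}
    (hφ : ContDiff ℝ 2 (Function.uncurry φ))
    (hsol : ∀ t, ∀ x ∈ Ioi (1 / 2 : ℝ), iteratedDeriv 2 (fun τ => φ τ x) t
        = iteratedDeriv 2 (φ t) x - W x * φ t x) :
    Continuous (Function.uncurry fun t x =>
        iteratedDeriv 2 (fun τ => φ τ x) t - iteratedDeriv 2 (φ t) x + W x * φ t x) ∧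
      ∀ t x, 1 ≤ x →
        iteratedDeriv 2 (fun τ => φ τ x) t - iteratedDeriv 2 (φ t) x + W x * φ t x = 0 := by
  obtain ⟨-, -, φtt, -, φxx, -, -, hctt, -, hcxx, -, -, -, -, -, -, h7, h8⟩ :=
    exists_partials_of_contDiff_two hφ
  refine ⟨?_, fun t x hx => ?_⟩
  · have : (Function.uncurry fun t x =>
        iteratedDeriv 2 (fun τ => φ τ x) t - iteratedDeriv 2 (φ t) x + W x * φ t x)
        = fun p : ℝ × ℝ => φtt p.1 p.2 - φxx p.1 p.2 + W p.2 * φ p.1 p.2 := by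
      funext p; simp only [Function.uncurry, h7, h8]
    rw [this]
    exact (hctt.sub hcxx).add ((hW.comp continuous_snd).mul hφ.continuous)
  · rw [hsol t x (show (1 / 2 : ℝ) < x by linarith)]; ring

/-- **Splitting the reduced data energy** between the cut-off data and the far part:
`∫_1^X e[(h−P, g−Q)] ≤ 2∫_1^X e[(χ_R h − P, χ_R g − Q)] + 2∫_1^X e[((1−χ_R)h, (1−χ_R)g)]`.
[folklore] -/
theorem reduced_energy_split {W χ h g P Q : ℝ → ℝ} (hW : Continuous W) (hW0 : ∀ x, 0 ≤ W x)
    (hχ : ContDiff ℝ 2 χ) (hh : ContDiff ℝ 2 h) (hg : ContDiff ℝ 1 g) (hP : ContDiff ℝ 2 P)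
    (hQ : ContDiff ℝ 1 Q) (R : ℝ) {X : ℝ} (hX : 1 ≤ X) :
    (∫ x in (1 : ℝ)..X, (deriv (fun y => h y - P y) x ^ 2 + W x * (h x - P x) ^ 2
        + (g x - Q x) ^ 2))
      ≤ 2 * (∫ x in (1 : ℝ)..X, (deriv (fun y => χ (y / R) * h y - P y) x ^ 2
          + W x * (χ (x / R) * h x - P x) ^ 2 + (χ (x / R) * g x - Q x) ^ 2))
        + 2 * ∫ x in (1 : ℝ)..X, (deriv (fun y => (1 - χ (y / R)) * h y) x ^ 2
          + W x * ((1 - χ (x / R)) * h x) ^ 2 + ((1 - χ (x / R)) * g x) ^ 2) := by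
  have hχR : ContDiff ℝ 2 fun x => χ (x / R) := hχ.comp (contDiff_id.div_const R)
  have hcC : ContDiff ℝ 2 fun y => χ (y / R) * h y - P y := (hχR.mul hh).sub hP
  have hfC : ContDiff ℝ 2 fun y => (1 - χ (y / R)) * h y := (contDiff_const.sub hχR).mul hh
  have hderiv : ∀ x, deriv (fun y => h y - P y) x
      = deriv (fun y => χ (y / R) * h y - P y) x + deriv (fun y => (1 - χ (y / R)) * h y) x := by
    intro x
    have e : (fun y => h y - P y)
        = fun y => (χ (y / R) * h y - P y) + (1 - χ (y / R)) * h y := by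
      funext y; ring
    rw [e]
    exact deriv_fun_add ((hcC.differentiable (by norm_num)) x)
      ((hfC.differentiable (by norm_num)) x)
  have hpt : ∀ x, deriv (fun y => h y - P y) x ^ 2 + W x * (h x - P x) ^ 2 + (g x - Q x) ^ 2
      ≤ 2 * (deriv (fun y => χ (y / R) * h y - P y) x ^ 2
          + W x * (χ (x / R) * h x - P x) ^ 2 + (χ (x / R) * g x - Q x) ^ 2)
        + 2 * (deriv (fun y => (1 - χ (y / R)) * h y) x ^ 2
          + W x * ((1 - χ (x / R)) * h x) ^ 2 + ((1 - χ (x / R)) * g x) ^ 2) := by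
    intro x
    rw [hderiv x]
    have hWx := hW0 x
    have key : ∀ a b : ℝ, (a + b) ^ 2 ≤ 2 * a ^ 2 + 2 * b ^ 2 := fun a b => by
      nlinarith [sq_nonneg (a - b)]
    have e1 := key (deriv (fun y => χ (y / R) * h y - P y) x)
      (deriv (fun y => (1 - χ (y / R)) * h y) x)
    have e2 := mul_le_mul_of_nonneg_left (key (χ (x / R) * h x - P x) ((1 - χ (x / R)) * h x)) hWx
    have e3 := key (χ (x / R) * g x - Q x) ((1 - χ (x / R)) * g x)
    have s1 : h x - P x = (χ (x / R) * h x - P x) + (1 - χ (x / R)) * h x := by ring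
    have s2 : g x - Q x = (χ (x / R) * g x - Q x) + (1 - χ (x / R)) * g x := by ring
    rw [s1, s2]
    linarith [e1, e2, e3]
  have cL : Continuous fun x => deriv (fun y => h y - P y) x ^ 2 + W x * (h x - P x) ^ 2
      + (g x - Q x) ^ 2 :=
    ((((hh.sub hP).continuous_deriv (by norm_num)).pow 2).add
      (hW.mul ((hh.sub hP).continuous.pow 2))).add ((hg.continuous.sub hQ.continuous).pow 2)
  have cRd : Continuous fun x => deriv (fun y => χ (y / R) * h y - P y) x ^ 2
      + W x * (χ (x / R) * h x - P x) ^ 2 + (χ (x / R) * g x - Q x) ^ 2 := by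
    refine ((Continuous.pow ?_ 2).add (hW.mul (hcC.continuous.pow 2))).add
      ((((hχR.continuous).mul hg.continuous).sub hQ.continuous).pow 2)
    exact hcC.continuous_deriv (by norm_num)
  have cef : Continuous fun x => deriv (fun y => (1 - χ (y / R)) * h y) x ^ 2
      + W x * ((1 - χ (x / R)) * h x) ^ 2 + ((1 - χ (x / R)) * g x) ^ 2 :=
    (((hfC.continuous_deriv (by norm_num)).pow 2).add (hW.mul (hfC.continuous.pow 2))).add
      (((continuous_const.sub hχR.continuous).mul hg.continuous).pow 2)
  rw [← intervalIntegral.integral_const_mul, ← intervalIntegral.integral_const_mul,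
    ← intervalIntegral.integral_add ((cRd.intervalIntegrable _ _).const_mul 2)
      ((cef.intervalIntegrable _ _).const_mul 2)]
  exact intervalIntegral.integral_mono_on hX (cL.intervalIntegrable _ _)
    (((cRd.intervalIntegrable _ _).const_mul 2).add ((cef.intervalIntegrable _ _).const_mul 2))
    fun x _ => hpt x

/-- **Channel limits of the cut-off wave**: if `φ`, `φR` are `C²` functions solving the
equation to the right of `x = 1` with finite initial energies there, and the initial energy density
of `φR − φ` on `(1,∞)` is `ef`, then `L±[φR] ≤ 2 L±[φ] + 2 ∫_{x>1} ef`. [folklore] -/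
theorem cutoff_limits_le {W : ℝ → ℝ} (hW : Continuous W) (hW0 : ∀ x, 0 ≤ W x)
    {φ φR F FR : ℝ → ℝ → ℝ} (hφC : ContDiff ℝ 2 (Function.uncurry φ))
    (hφRC : ContDiff ℝ 2 (Function.uncurry φR)) (hFc : Continuous (Function.uncurry F))
    (hFRc : Continuous (Function.uncurry FR))
    (hsolF : ∀ t x, iteratedDeriv 2 (fun τ => φ τ x) t - iteratedDeriv 2 (φ t) x + W x * φ t x
      = F t x)
    (hsolFR : ∀ t x, iteratedDeriv 2 (fun τ => φR τ x) t - iteratedDeriv 2 (φR t) x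
      + W x * φR t x = FR t x)
    (hF0 : ∀ τ x, (1 : ℝ) ≤ x → F τ x = 0) (hFR0 : ∀ τ x, (1 : ℝ) ≤ x → FR τ x = 0)
    (hfin : ∫⁻ x in Ioi 1, ENNReal.ofReal
      (deriv (fun τ => φ τ x) 0 ^ 2 + deriv (φ 0) x ^ 2 + W x * φ 0 x ^ 2) < ⊤)
    (hfinR : ∫⁻ x in Ioi 1, ENNReal.ofReal
      (deriv (fun τ => φR τ x) 0 ^ 2 + deriv (φR 0) x ^ 2 + W x * φR 0 x ^ 2) < ⊤)
    {ef : ℝ → ℝ} (hef0 : ∀ x, 0 ≤ ef x) (hIfar : IntegrableOn ef (Ioi 1))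
    (hdiff0 : ∀ x, deriv (fun τ => φR τ x - φ τ x) 0 ^ 2
      + deriv (fun y => φR 0 y - φ 0 y) x ^ 2 + W x * (φR 0 x - φ 0 x) ^ 2 = ef x)
    {Lp Lm LpR LmR : ℝ}
    (hlimp : Tendsto (fun t => ∫ x in Ioi (1 + |t|),
      (deriv (fun τ => φ τ x) t ^ 2 + deriv (φ t) x ^ 2 + W x * φ t x ^ 2)) atTop (𝓝 Lp))
    (hlimm : Tendsto (fun t => ∫ x in Ioi (1 + |t|),
      (deriv (fun τ => φ τ x) t ^ 2 + deriv (φ t) x ^ 2 + W x * φ t x ^ 2)) atBot (𝓝 Lm))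
    (hlimpR : Tendsto (fun t => ∫ x in Ioi (1 + t),
      (deriv (fun τ => φR τ x) t ^ 2 + deriv (φR t) x ^ 2 + W x * φR t x ^ 2)) atTop (𝓝 LpR))
    (hlimmR : Tendsto (fun t => ∫ x in Ioi (1 - t),
      (deriv (fun τ => φR τ x) t ^ 2 + deriv (φR t) x ^ 2 + W x * φR t x ^ 2)) atBot (𝓝 LmR)) :
    LpR ≤ 2 * Lp + 2 * ∫ x in Ioi 1, ef x ∧ LmR ≤ 2 * Lm + 2 * ∫ x in Ioi 1, ef x := by
  set η : ℝ := ∫ x in Ioi 1, ef x with hη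
  have hη0 : 0 ≤ η := setIntegral_nonneg measurableSet_Ioi fun x _ => hef0 x
  set E : ℝ → ℝ := fun t => ∫ x in Ioi (1 + |t|),
    (deriv (fun τ => φ τ x) t ^ 2 + deriv (φ t) x ^ 2 + W x * φ t x ^ 2) with hE
  set ER : ℝ → ℝ := fun t => ∫ x in Ioi (1 + |t|),
    (deriv (fun τ => φR τ x) t ^ 2 + deriv (φR t) x ^ 2 + W x * φR t x ^ 2) with hER
  have hEint := fun t => wave1D_farEnergy_integrableOn hW hW0 hFc hφC hsolF (c := 1) hF0 hfin t
  have hERint := fun t =>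
    wave1D_farEnergy_integrableOn hW hW0 hFRc hφRC hsolFR (c := 1) hFR0 hfinR t
  have htwo : ∀ t, ER t ≤ 2 * E t + 2 * η := by
    intro t
    have h2 := wave1D_farEnergy_lintegral_two hW hW0 hFRc hFc hφRC hφC hsolFR hsolF (c := 1)
      hFR0 hF0 t
    simp only [hdiff0] at h2
    have hEt0 : 0 ≤ E t := setIntegral_nonneg measurableSet_Ioi fun x _ =>
      wave1D_energyDensity_nonneg (ψ := φ) hW0 t x
    have h2E : (0 : ℝ) ≤ 2 * E t := by positivity
    have h2η : (0 : ℝ) ≤ 2 * η := by positivity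
    rw [← (hERint t).2, ← (hEint t).2, ← ofReal_integral_eq_lintegral_ofReal hIfar
      (ae_of_all _ hef0), ← ENNReal.ofReal_ofNat 2, ← ENNReal.ofReal_mul (by norm_num),
      ← ENNReal.ofReal_mul (by norm_num), ← ENNReal.ofReal_add h2E h2η] at h2
    exact (ENNReal.ofReal_le_ofReal_iff (by positivity)).1 h2
  constructor
  · have hlimER : Tendsto ER atTop (𝓝 LpR) := by
      refine hlimpR.congr' ?_
      filter_upwards [Filter.eventually_ge_atTop 0] with t ht
      simp only [hER, abs_of_nonneg ht]
    exact le_of_tendsto_of_tendsto hlimER ((hlimp.const_mul 2).add_const (2 * η))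
      (Filter.Eventually.of_forall htwo)
  · have hlimER : Tendsto ER atBot (𝓝 LmR) := by
      refine hlimmR.congr' ?_
      filter_upwards [Filter.eventually_le_atBot 0] with t ht
      simp only [hER, abs_of_nonpos ht, sub_eq_add_neg]
    exact le_of_tendsto_of_tendsto hlimER ((hlimm.const_mul 2).add_const (2 * η))
      (Filter.Eventually.of_forall htwo)

/-- **Exact inverse-square exterior channel estimate, finite-energy data.** See the module
docstring. [cite: KenigEtAl2015, Theorem 5 (exterior energy, odd d)] -/
theorem inverseSquare_channel_estimate (hι : ContDiff ℝ (⊤ : ℕ∞) ι)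
    (hιeq : ∀ x : ℝ, 1 / 2 ≤ x → ι x = x⁻¹) {I : ℝ → ℝ} (hI : ContDiff ℝ (⊤ : ℕ∞) I)
    (hI' : ∀ x, HasDerivAt I (ι x) x) (n : ℕ) :
    ∃ c : ℝ, 0 < c ∧ ∀ (h g : ℝ → ℝ), ContDiff ℝ 2 h → ContDiff ℝ 1 g →
      IntegrableOn (fun x => deriv h x ^ 2) (Ioi 1) →
      IntegrableOn (fun x => (n : ℝ) * (n + 1) * ι x ^ 2 * h x ^ 2) (Ioi 1) →
      IntegrableOn (fun x => g x ^ 2) (Ioi 1) →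
      ∃ (φ : ℝ → ℝ → ℝ) (Lp Lm : ℝ),
        ContDiff ℝ 2 (Function.uncurry φ) ∧
        (∀ t, ∀ x ∈ Ioi (1 / 2 : ℝ), iteratedDeriv 2 (fun τ => φ τ x) t
            = iteratedDeriv 2 (φ t) x - n * (n + 1) * ι x ^ 2 * φ t x) ∧
        (∀ x, φ 0 x = h x) ∧ (∀ x, deriv (fun τ => φ τ x) 0 = g x) ∧ 0 ≤ Lp ∧ 0 ≤ Lm ∧
        Tendsto (fun t => ∫ x in Ioi (1 + |t|),
          (deriv (fun τ => φ τ x) t ^ 2 + deriv (φ t) x ^ 2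
            + (n : ℝ) * (n + 1) * ι x ^ 2 * φ t x ^ 2)) atTop (𝓝 Lp) ∧
        Tendsto (fun t => ∫ x in Ioi (1 + |t|),
          (deriv (fun τ => φ τ x) t ^ 2 + deriv (φ t) x ^ 2
            + (n : ℝ) * (n + 1) * ι x ^ 2 * φ t x ^ 2)) atBot (𝓝 Lm) ∧
        ∀ δ : ℝ, 0 < δ → ∃ ch cg : ℕ → ℝ, ∀ X : ℝ, 1 ≤ X →
          c * ∫ x in (1 : ℝ)..X,
            (deriv (fun y => h y - ladder ι n (fun z => ∑ m ∈ range (n + 1),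
                ch m / m.factorial * (z - 1) ^ m) y) x ^ 2
              + (n : ℝ) * (n + 1) * ι x ^ 2 * (h x - ladder ι n (fun z => ∑ m ∈ range (n + 1),
                ch m / m.factorial * (z - 1) ^ m) x) ^ 2
              + (g x - ladder ι n (fun z => ∑ m ∈ range n,
                cg m / m.factorial * (z - 1) ^ m) x) ^ 2)
            ≤ Lp + Lm + δ := by
  obtain ⟨c₂, hc₂, hV2⟩ := inverseSquare_channel_estimate_compact hι hιeq hI hI' n
  obtain ⟨χ, hχC, hχ1, hχ2, hχ01, C, -, hC⟩ := exists_smooth_cutoff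
  refine ⟨c₂ / 4, by positivity, ?_⟩
  intro h g hh hg i1 i2 i3
  -- the potential
  set W : ℝ → ℝ := fun x => (n : ℝ) * (n + 1) * ι x ^ 2 with hW
  have hWc : Continuous W := continuous_const.mul (hι.continuous.pow 2)
  have hW0 : ∀ x, 0 ≤ W x := fun x => by simp only [hW]; positivity
  -- the wave and its residual
  obtain ⟨φ, hφC, hφsol, hφ0, hφ1⟩ := exists_inverseSquare_wave hι hιeq hI hI' n hh hg
  obtain ⟨hFc, hF0⟩ := inverseSquare_residual (W := W) hWc hφC hφsol
  have hsolF : ∀ t x, iteratedDeriv 2 (fun τ => φ τ x) t - iteratedDeriv 2 (φ t) x + W x * φ t x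
      = (fun t x => iteratedDeriv 2 (fun τ => φ τ x) t - iteratedDeriv 2 (φ t) x
        + W x * φ t x) t x := fun t x => rfl
  -- finite initial energy
  have hφ0f : φ 0 = h := funext hφ0
  have hdens0 : ∀ x, deriv (fun τ => φ τ x) 0 ^ 2 + deriv (φ 0) x ^ 2 + W x * φ 0 x ^ 2
      = deriv h x ^ 2 + W x * h x ^ 2 + g x ^ 2 := by
    intro x; rw [hφ1 x, hφ0f]; ring
  have hIe : IntegrableOn (fun x => deriv h x ^ 2 + W x * h x ^ 2 + g x ^ 2) (Ioi 1) :=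
    (i1.add i2).add i3
  have hfin : ∫⁻ x in Ioi 1, ENNReal.ofReal
      (deriv (fun τ => φ τ x) 0 ^ 2 + deriv (φ 0) x ^ 2 + W x * φ 0 x ^ 2) < ⊤ := by
    simp only [hdens0]
    rw [← ofReal_integral_eq_lintegral_ofReal hIe (ae_of_all _ fun x => by
      have := hW0 x; positivity)]
    exact ENNReal.ofReal_lt_top
  -- channel limits
  obtain ⟨Lp, Lm, hLp0, hLm0, -, -, hlimp, hlimm⟩ :=
    wave1D_exists_farEnergy_limits hWc hW0 hFc hφC hsolF (c := 1) hF0 hfin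
  refine ⟨φ, Lp, Lm, hφC, hφsol, hφ0, hφ1, hLp0, hLm0, hlimp, hlimm, fun δ hδ => ?_⟩
  -- the cut-off scale
  have hε : 0 < 2 * δ / (4 + c₂) := by positivity
  obtain ⟨R, hR1, hRprop⟩ := energy_tail_cutoff_small (hh.of_le (by norm_num)) hg.continuous hWc
    hW0 i1 i2 i3 hχC hχ1 hχ2 hχ01 hC hε
  obtain ⟨hIfar, hηle⟩ := hRprop R le_rfl
  set ef : ℝ → ℝ := fun x => deriv (fun y => (1 - χ (y / R)) * h y) x ^ 2
    + W x * ((1 - χ (x / R)) * h x) ^ 2 + ((1 - χ (x / R)) * g x) ^ 2 with hef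
  have hef0 : ∀ x, 0 ≤ ef x := fun x => by have := hW0 x; simp only [hef]; positivity
  have hR0 : 0 < R := by linarith
  -- cut-off data and the cut-off wave
  have hχR : ∀ N : ℕ, ContDiff ℝ N fun x => χ (x / R) := fun N =>
    (contDiff_infty.1 hχC N).comp (contDiff_id.div_const R)
  have hhcC : ContDiff ℝ 2 fun x => χ (x / R) * h x := (hχR 2).mul hh
  have hgcC : ContDiff ℝ 1 fun x => χ (x / R) * g x := (hχR 1).mul hg
  have hχ0R : ∀ x, 2 * R ≤ x → χ (x / R) = 0 := fun x hx =>
    hχ2 _ ((le_div_iff₀ hR0).2 (by linarith))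
  have hhcB : ∀ x, 2 * R ≤ x → χ (x / R) * h x = 0 := fun x hx => by rw [hχ0R x hx, zero_mul]
  have hgcB : ∀ x, 2 * R ≤ x → χ (x / R) * g x = 0 := fun x hx => by rw [hχ0R x hx, zero_mul]
  obtain ⟨φR, ch, cg, LpR, LmR, hφRC, hφRsol, hφR0, hφR1, hlimpR, hlimmR, hest⟩ :=
    hV2 _ _ hhcC hgcC (2 * R) (by linarith) hhcB hgcB
  refine ⟨ch, cg, fun X hX => ?_⟩
  obtain ⟨hFRc, hFR0⟩ := inverseSquare_residual (W := W) hWc hφRC hφRsol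
  have hsolFR : ∀ t x, iteratedDeriv 2 (fun τ => φR τ x) t - iteratedDeriv 2 (φR t) x
      + W x * φR t x = (fun t x => iteratedDeriv 2 (fun τ => φR τ x) t - iteratedDeriv 2 (φR t) x
        + W x * φR t x) t x := fun t x => rfl
  -- finite initial energy of the cut-off wave
  have hφR0f : φR 0 = fun x => χ (x / R) * h x := funext hφR0
  have hdensR : ∀ x, deriv (fun τ => φR τ x) 0 ^ 2 + deriv (φR 0) x ^ 2 + W x * φR 0 x ^ 2
      = deriv (fun y => χ (y / R) * h y) x ^ 2 + W x * (χ (x / R) * h x) ^ 2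
        + (χ (x / R) * g x) ^ 2 := by
    intro x; rw [hφR1 x, hφR0f]; ring
  have hcR : Continuous fun x => deriv (fun y => χ (y / R) * h y) x ^ 2
      + W x * (χ (x / R) * h x) ^ 2 + (χ (x / R) * g x) ^ 2 :=
    (((hhcC.continuous_deriv (by norm_num)).pow 2).add (hWc.mul (hhcC.continuous.pow 2))).add
      (hgcC.continuous.pow 2)
  have hIeR : IntegrableOn (fun x => deriv (fun y => χ (y / R) * h y) x ^ 2
      + W x * (χ (x / R) * h x) ^ 2 + (χ (x / R) * g x) ^ 2) (Ioi 1) := by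
    rw [← Ioc_union_Ioi_eq_Ioi (by linarith : (1 : ℝ) ≤ 2 * R)]
    refine (hcR.continuousOn.integrableOn_Icc.mono_set Ioc_subset_Icc_self).union ?_
    refine integrableOn_zero.congr_fun (fun x hx => ?_) measurableSet_Ioi
    have hx' : 2 * R < x := hx
    have hd0 : deriv (fun y => χ (y / R) * h y) x = 0 := by
      have hev : (fun y => χ (y / R) * h y) =ᶠ[𝓝 x] fun _ => 0 :=
        Filter.mem_of_superset (Ioi_mem_nhds hx') fun y hy => hhcB y (le_of_lt hy)
      rw [hev.deriv_eq, deriv_const]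
    simp [hd0, hhcB x hx'.le, hgcB x hx'.le]
  have hfinR : ∫⁻ x in Ioi 1, ENNReal.ofReal
      (deriv (fun τ => φR τ x) 0 ^ 2 + deriv (φR 0) x ^ 2 + W x * φR 0 x ^ 2) < ⊤ := by
    simp only [hdensR]
    rw [← ofReal_integral_eq_lintegral_ofReal hIeR (ae_of_all _ fun x => by
      have := hW0 x; positivity)]
    exact ENNReal.ofReal_lt_top
  -- the difference wave has initial energy density `ef`
  have hdiff0 : ∀ x, deriv (fun τ => φR τ x - φ τ x) 0 ^ 2
      + deriv (fun y => φR 0 y - φ 0 y) x ^ 2 + W x * (φR 0 x - φ 0 x) ^ 2 = ef x := by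
    intro x
    have hd1 : deriv (fun τ => φR τ x - φ τ x) 0 = χ (x / R) * g x - g x := by
      have a : DifferentiableAt ℝ (fun τ => φR τ x) 0 :=
        (hφRC.comp (contDiff_id.prodMk contDiff_const)).differentiable (by norm_num) 0
      have b : DifferentiableAt ℝ (fun τ => φ τ x) 0 :=
        (hφC.comp (contDiff_id.prodMk contDiff_const)).differentiable (by norm_num) 0
      rw [deriv_fun_sub a b, hφR1 x, hφ1 x]
    have hd2 : deriv (fun y => φR 0 y - φ 0 y) x = -deriv (fun y => (1 - χ (y / R)) * h y) x := by
      have e : (fun y => φR 0 y - φ 0 y) = fun y => -((1 - χ (y / R)) * h y) := by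
        funext y; rw [hφR0 y, hφ0 y]; ring
      rw [e, deriv.fun_neg]
    have hd3 : φR 0 x - φ 0 x = -((1 - χ (x / R)) * h x) := by rw [hφR0 x, hφ0 x]; ring
    rw [hd1, hd2, hd3]
    simp only [hef]; ring
  -- (i) channel limits of the cut-off wave
  obtain ⟨hLpR, hLmR⟩ := cutoff_limits_le hWc hW0 hφC hφRC hFc hFRc hsolF hsolFR hF0 hFR0 hfin
    hfinR hef0 hIfar hdiff0 hlimp hlimm hlimpR hlimmR
  -- (ii) data splitting on `[1, X]`
  have hThC : ContDiff ℝ 2 (ladder ι n fun z => ∑ m ∈ range (n + 1),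
      ch m / m.factorial * (z - 1) ^ m) := contDiff_ladder hι (m := 2) (contDiff_taylorSum _ _ _)
  have hTgC : ContDiff ℝ 1 (ladder ι n fun z => ∑ m ∈ range n,
      cg m / m.factorial * (z - 1) ^ m) :=
    contDiff_ladder hι (m := 1) (ContDiff.sum fun m _ =>
      contDiff_const.mul ((contDiff_id.sub contDiff_const).pow m))
  have hsplit := reduced_energy_split (W := W) hWc hW0 (contDiff_infty.1 hχC 2) hh hg hThC hTgC R hX
  have hef_le : (∫ x in (1 : ℝ)..X, ef x) ≤ ∫ x in Ioi 1, ef x := by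
    rw [intervalIntegral.integral_of_le hX]
    exact setIntegral_mono_set hIfar (ae_of_all _ hef0) (ae_of_all _ Ioc_subset_Ioi_self)
  have hestX := hest X hX
  -- (iii) arithmetic
  set η := ∫ x in Ioi 1, ef x with hη
  have hη0 : 0 ≤ η := setIntegral_nonneg measurableSet_Ioi fun x _ => hef0 x
  have hηδ : (2 + c₂ / 2) * η ≤ δ := by
    have h2 : (2 + c₂ / 2) * (2 * δ / (4 + c₂)) = δ := by field_simp; ring
    calc (2 + c₂ / 2) * η ≤ (2 + c₂ / 2) * (2 * δ / (4 + c₂)) :=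
          mul_le_mul_of_nonneg_left hηle (by positivity)
      _ = δ := h2
  set A := ∫ x in (1 : ℝ)..X,
    (deriv (fun y => h y - ladder ι n (fun z => ∑ m ∈ range (n + 1),
        ch m / m.factorial * (z - 1) ^ m) y) x ^ 2
      + W x * (h x - ladder ι n (fun z => ∑ m ∈ range (n + 1),
        ch m / m.factorial * (z - 1) ^ m) x) ^ 2
      + (g x - ladder ι n (fun z => ∑ m ∈ range n,
        cg m / m.factorial * (z - 1) ^ m) x) ^ 2) with hA
  set B := ∫ x in (1 : ℝ)..X,
    (deriv (fun y => χ (y / R) * h y - ladder ι n (fun z => ∑ m ∈ range (n + 1),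
        ch m / m.factorial * (z - 1) ^ m) y) x ^ 2
      + W x * (χ (x / R) * h x - ladder ι n (fun z => ∑ m ∈ range (n + 1),
        ch m / m.factorial * (z - 1) ^ m) x) ^ 2
      + (χ (x / R) * g x - ladder ι n (fun z => ∑ m ∈ range n,
        cg m / m.factorial * (z - 1) ^ m) x) ^ 2) with hB
  have hBle : c₂ * B ≤ LpR + LmR := hestX
  have hA' : A ≤ 2 * B + 2 * η := by
    have : A ≤ 2 * B + 2 * ∫ x in (1 : ℝ)..X, ef x := hsplit
    linarith [hef_le]
  clear_value A B η ef W
  have hB' : B ≤ (LpR + LmR) / c₂ := by rw [le_div_iff₀ hc₂]; linarith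
  calc c₂ / 4 * A ≤ c₂ / 4 * (2 * B + 2 * η) := mul_le_mul_of_nonneg_left hA' (by positivity)
    _ ≤ c₂ / 4 * (2 * ((LpR + LmR) / c₂) + 2 * η) := by gcongr
    _ = (LpR + LmR) / 2 + c₂ / 2 * η := by field_simp; ring
    _ ≤ (2 * Lp + 2 * η + (2 * Lm + 2 * η)) / 2 + c₂ / 2 * η := by gcongr
    _ = Lp + Lm + (2 + c₂ / 2) * η := by ring
    _ ≤ Lp + Lm + δ := by linarith [hηδ]

end Literature.Analysis.PDE
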